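/-
O(2) `{φ, s, t}` scan: rule (M) for the charged sectors `1`, `2⁺`, `2⁻`, `3`, `4` on a BOX of external
dimensions.
-/
import Literature.MathematicalPhysics.QuantumFieldTheory.O2DimBox
import Literature.MathematicalPhysics.QuantumFieldTheory.O2ChargedSectorsTail
import Literature.MathematicalPhysics.QuantumFieldTheory.O2ChargedSectorsRules
import HarnessLib

/-!
# O(2) `{φ, s, t}` scan: rule (M) for the charged sectors on a BOX of external dimensions

Companion of `O2NeutralDimBox`.  At ONE external point `D` the tree decides the (M)-range obligations of the
charged sectors from closed-form corner numbers at the exponent `s = D.expo L` (or the aligned exponents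
`expoQ D`, `expoW1 D`): the kernel tests `kernelTest2p_on_box`, `kernelTest1_on_box` (`O2ChargedSectorsTail`,
§2) for the `2 × 2` sectors `2⁺`, `1`, and one sign `twTerm_nonneg_on_box` (`O2ChargedSectorsRules`) for the
`1 × 1` sectors `2⁻`, `3`, `4`.  All entries are two-weight evaluations whose weights do not depend on `D`;
the exponents are half-sums of external dimensions (`O2DimBox.expo_mem_Icc`; `expoQ D = expoW1 D = (Δ_φ+Δ_t)/2`,
`expoQ_mem_Icc`, `expoW1_mem_Icc` below), so replacing `(s, s)` by the exponent INTERVAL of a box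
`lo ≤ D ≤ hi` in every corner number gives the same rules UNIFORMLY IN `D`:

1. **`kernelTest2p_on_dbox`**, **`kernelTest1_on_dbox`** — `X, Y ≥ 0`, `Z² ≤ 4 X Y` on the box numbers ⇒ the
   kernel test at every `D` in the box and every `E ∈ [E₁, E₂]`;
2. **`twTerm_nonneg_on_dbox`** and its three instances **`dom2mTerm_nonneg_on_dbox`**, **`dom3Term_nonneg_on_dbox`**,
   **`sector4Term_nonneg_on_dbox`** — one corner number `≥ 0` ⇒ the sector's term `≥ 0` likewise.

Same reader-side data shape as the point rules; proofs are the tree's with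
`O2DimBox.twoWeightEval_mem_Icc_corner_expo` / `twoWeightEval_mem_Icc_corner₂` in place of
`twoWeightEval_mem_Icc_corner`.  (Chester et al. test finitely many external points and triangulate, §3.3–§3.4;
a certificate for a CELL of external dimensions needs every rule uniformly on the cell.)
-/

noncomputable section

namespace Literature.MathematicalPhysics.QuantumFieldTheory.O2ChargedDimBox

open Set Finset Matrix
open Literature.MathematicalPhysics.QuantumFieldTheory.ConformalBootstrap3D
open O2ThreeScalarCrossing O2ThreeScalarSystem O2OPEScanBridge O2ScanObligations
open O2NeutralSectorsTermwise O2ChargedSectorsTermwise O2ChargeTwoEvenTermwise O2ChargeOneTermwise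
open O2ChargedSectorsCells O2ChargedSectorsTail O2ChargeFourRules O2ChargedSectorsRules O2DimBox

/-- `lo ≤ x ≤ hi ⇒ |x| ≤ max (−lo) hi` (private helper). [folklore] -/
private theorem abs_le_max_of_mem' {x lo hi : ℝ} (h1 : lo ≤ x) (h2 : x ≤ hi) :
    |x| ≤ max (-lo) hi := by
  rw [abs_le]
  exact ⟨by linarith [le_max_left (-lo) hi], h2.trans (le_max_right _ _)⟩

/-! ## 1. The aligned exponents on a box of external dimensions -/

/-- `expoQ D = (Δ_φ + Δ_t)/2` lies between its corner values on a box.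
[cite: DolanOsborn2011, §2 eqs. (2.43)–(2.44)] [cite: ChesterEtAl2020, §3.3 (scanning over external dimensions)] -/
theorem expoQ_mem_Icc {lo hi D : Dims} (h : InDimBox lo hi D) : expoQ D ∈ Icc (expoQ lo) (expoQ hi) := by
  obtain ⟨⟨hs1, hs2⟩, ⟨hp1, hp2⟩, ⟨ht1, ht2⟩⟩ := h
  simp only [expoQ, Dims.expo, Set.mem_Icc]
  constructor <;> linarith

/-- `expoW1 D = (Δ_φ + Δ_t)/2` lies between its corner values on a box.
[cite: DolanOsborn2011, §2 eqs. (2.43)–(2.44)] [cite: ChesterEtAl2020, §3.3 (scanning over external dimensions)] -/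
theorem expoW1_mem_Icc {lo hi D : Dims} (h : InDimBox lo hi D) :
    expoW1 D ∈ Icc (expoW1 lo) (expoW1 hi) := by
  obtain ⟨⟨hs1, hs2⟩, ⟨hp1, hp2⟩, ⟨ht1, ht2⟩⟩ := h
  simp only [expoW1, Dims.expo, Set.mem_Icc]
  constructor <;> linarith

/-! ## 2. The kernel tests of sectors `2⁺` and `1` on a box of external dimensions -/

/-- **Rule (M), sector `2⁺`, uniform on a box of external dimensions**: with the corner numbers at the
exponent intervals, `X = cb(c_P, d_P; [lo.Δφ, hi.Δφ])`, `Y = cb(c₂, d₂; [s_{stts}(lo), s_{stts}(hi)])`,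
`Z = max(−cb(c_Q, d_Q; [expoQ lo, expoQ hi]), −cb(−c_Q, −d_Q; …))`, the checks `X, Y ≥ 0`, `Z² ≤ 4 X Y` give
the `2⁺` kernel test at every `D` with `lo ≤ D ≤ hi` and every `E ∈ [E₁, E₂]`.
[cite: HogervorstRychkov2013, §3 eqs. (3.6), (3.9)] [cite: ChesterEtAl2020, §3.3 (scanning over external dimensions)] -/
theorem kernelTest2p_on_dbox (F : ScanFunctional) {lo hi : Dims} (j : ℕ) {E₁ E₂ : ℝ}
    (hX : 0 ≤ cornerBound₂ (cwP F) (dwP F) F.z F.zb j E₁ E₂ (lo.expo .φφφφ) (hi.expo .φφφφ))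
    (hY : 0 ≤ cornerBound₂ (cWeight2m F) (dWeight2m F) F.z F.zb j E₁ E₂ (lo.expo .stts) (hi.expo .stts))
    (hdet : max (-cornerBound₂ (cwQ F) (dwQ F) F.z F.zb j E₁ E₂ (expoQ lo) (expoQ hi))
        (-cornerBound₂ (-cwQ F) (-dwQ F) F.z F.zb j E₁ E₂ (expoQ lo) (expoQ hi)) ^ 2 ≤
      4 * cornerBound₂ (cwP F) (dwP F) F.z F.zb j E₁ E₂ (lo.expo .φφφφ) (hi.expo .φφφφ) *
        cornerBound₂ (cWeight2m F) (dWeight2m F) F.z F.zb j E₁ E₂ (lo.expo .stts) (hi.expo .stts)) :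
    ∀ D, InDimBox lo hi D → ∀ E ∈ Icc E₁ E₂, kernelTest2p F D E j := by
  intro D hD E hE
  have hP := twoWeightEval_mem_Icc_corner_expo F (cwP F) (dwP F) j hE hD .φφφφ
  have hDm := twoWeightEval_mem_Icc_corner_expo F (cWeight2m F) (dWeight2m F) j hE hD .stts
  have hQ := twoWeightEval_mem_Icc_corner₂ F (cwQ F) (dwQ F) j hE (expoQ_mem_Icc hD)
  rw [← pForm2p_eq_twoWeightEval] at hP
  rw [← dom2mTerm_eq_twoWeightEval] at hDm
  rw [← qForm2pA_eq_twoWeightEval] at hQ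
  exact test_of_enclosures hP.1 hDm.1 (abs_le_max_of_mem' hQ.1 hQ.2) hX hY hdet

/-- **Rule (M), sector `1`, uniform on a box of external dimensions** (certificate constant `κ`):
`X = cb(cˣ_κ, dˣ_κ; [lo.Δφ, hi.Δφ])`, `Y = cb(cʸ_κ, dʸ_κ; [lo.Δt, hi.Δt])`,
`Z = max(−cb(c_W, c_W; [expoW1 lo, expoW1 hi]), −cb(−c_W, −c_W; …))`, `X, Y ≥ 0`, `Z² ≤ 4 X Y` ⇒ the
sector-`1` kernel test at every `D` with `lo ≤ D ≤ hi` and every `E ∈ [E₁, E₂]`.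
[cite: HogervorstRychkov2013, §3 eqs. (3.6), (3.9)] [cite: ChesterEtAl2020, §3.3 (scanning over external dimensions)] -/
theorem kernelTest1_on_dbox (F : ScanFunctional) {lo hi : Dims} (κ : ℝ) (j : ℕ) {E₁ E₂ : ℝ}
    (hX : 0 ≤ cornerBound₂ (cWeightX1 F κ) (dWeightX1 F κ) F.z F.zb j E₁ E₂ (lo.expo .sφφs)
      (hi.expo .sφφs))
    (hY : 0 ≤ cornerBound₂ (cWeightY1 F κ) (dWeightY1 F κ) F.z F.zb j E₁ E₂ (lo.expo .φttφ)
      (hi.expo .φttφ))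
    (hdet : max (-cornerBound₂ (cwW1 F) (cwW1 F) F.z F.zb j E₁ E₂ (expoW1 lo) (expoW1 hi))
        (-cornerBound₂ (-cwW1 F) (-cwW1 F) F.z F.zb j E₁ E₂ (expoW1 lo) (expoW1 hi)) ^ 2 ≤
      4 * cornerBound₂ (cWeightX1 F κ) (dWeightX1 F κ) F.z F.zb j E₁ E₂ (lo.expo .sφφs) (hi.expo .sφφs) *
        cornerBound₂ (cWeightY1 F κ) (dWeightY1 F κ) F.z F.zb j E₁ E₂ (lo.expo .φttφ)
          (hi.expo .φttφ)) :
    ∀ D, InDimBox lo hi D → ∀ E ∈ Icc E₁ E₂, kernelTest1 F D κ E j := by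
  intro D hD E hE
  have hXe := twoWeightEval_mem_Icc_corner_expo F (cWeightX1 F κ) (dWeightX1 F κ) j hE hD .sφφs
  have hYe := twoWeightEval_mem_Icc_corner_expo F (cWeightY1 F κ) (dWeightY1 F κ) j hE hD .φttφ
  have hW := twoWeightEval_mem_Icc_corner₂ F (cwW1 F) (cwW1 F) j hE (expoW1_mem_Icc hD)
  rw [← domX1Term_eq_twoWeightEval] at hXe
  rw [← domY1Term_eq_twoWeightEval] at hYe
  rw [← w1Form1A_eq_twoWeightEval] at hW
  exact test_of_enclosures hXe.1 hYe.1 (abs_le_max_of_mem' hW.1 hW.2) hX hY hdet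

/-! ## 3. The `1 × 1` sectors `2⁻`, `3`, `4` on a box of external dimensions -/

/-- **Rule (M) for a two-weight term, uniform on a box of external dimensions**:
`cb(c, d; j, E₁, E₂, lo.expo L, hi.expo L) ≥ 0 ⇒ T(c, d; D.expo L)[𝒫_{E,j}] ≥ 0` for every `D` with
`lo ≤ D ≤ hi` and every `E ∈ [E₁, E₂]`. [cite: HogervorstRychkov2013, §3 eq. (3.6)]
[cite: ChesterEtAl2020, §3.3 (scanning over external dimensions)] -/
theorem twTerm_nonneg_on_dbox (F : ScanFunctional) (c d : Fin F.M → ℝ) (L : Label) (j : ℕ) {E₁ E₂ : ℝ}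
    {lo hi : Dims} (h : 0 ≤ cornerBound₂ c d F.z F.zb j E₁ E₂ (lo.expo L) (hi.expo L)) :
    ∀ D, InDimBox lo hi D → ∀ E ∈ Icc E₁ E₂, 0 ≤ twTerm F c d (D.expo L) E j :=
  fun _ hD _ hE => h.trans (twoWeightEval_mem_Icc_corner_expo F c d j hE hD L).1

/-- **Rule (M), sector `2⁻`, uniform on a box of external dimensions.**
[cite: HogervorstRychkov2013, §3 eq. (3.6)] [cite: ChesterEtAl2020, §3.3 (scanning over external dimensions)] -/
theorem dom2mTerm_nonneg_on_dbox (F : ScanFunctional) (j : ℕ) {E₁ E₂ : ℝ} {lo hi : Dims}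
    (h : 0 ≤ cornerBound₂ (cWeight2m F) (dWeight2m F) F.z F.zb j E₁ E₂ (lo.expo .stts) (hi.expo .stts)) :
    ∀ D, InDimBox lo hi D → ∀ E ∈ Icc E₁ E₂, 0 ≤ dom2mTerm F D E j :=
  fun D hD E hE => by
    rw [dom2mTerm_eq_twTerm]; exact twTerm_nonneg_on_dbox F _ _ .stts j h D hD E hE

/-- **Rule (M), sector `3`, uniform on a box of external dimensions.**
[cite: HogervorstRychkov2013, §3 eq. (3.6)] [cite: ChesterEtAl2020, §3.3 (scanning over external dimensions)] -/
theorem dom3Term_nonneg_on_dbox (F : ScanFunctional) (j : ℕ) {E₁ E₂ : ℝ} {lo hi : Dims}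
    (h : 0 ≤ cornerBound₂ (cWeight3 F) (dWeight3 F) F.z F.zb j E₁ E₂ (lo.expo .φttφ) (hi.expo .φttφ)) :
    ∀ D, InDimBox lo hi D → ∀ E ∈ Icc E₁ E₂, 0 ≤ dom3Term F D E j :=
  fun D hD E hE => by
    rw [dom3Term_eq_twTerm]; exact twTerm_nonneg_on_dbox F _ _ .φttφ j h D hD E hE

/-- **Rule (M), sector `4`, uniform on a box of external dimensions.**
[cite: HogervorstRychkov2013, §3 eqs. (3.6), (3.9)] [cite: ChesterEtAl2020, §3.3 (scanning over external dimensions)] -/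
theorem sector4Term_nonneg_on_dbox (F : ScanFunctional) (j : ℕ) {E₁ E₂ : ℝ} {lo hi : Dims}
    (h : 0 ≤ cornerBound₂ (cWeight4 F) (dWeight4 F) F.z F.zb j E₁ E₂ (lo.expo .tttt) (hi.expo .tttt)) :
    ∀ D, InDimBox lo hi D → ∀ E ∈ Icc E₁ E₂, 0 ≤ sector4Term F D E j :=
  fun D hD E hE => by
    rw [sector4Term_eq_twoWeightEval]
    exact h.trans (twoWeightEval_mem_Icc_corner_expo F _ _ j hE hD .tttt).1

/-! ## 4. The point rules are the degenerate box -/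

/-- The tree's point rule for `2⁺` is the case `lo = hi = D` of the box rule.
[cite: HogervorstRychkov2013, §3 eqs. (3.6), (3.9)] -/
theorem kernelTest2p_on_box_of_dbox (F : ScanFunctional) (D : Dims) (j : ℕ) {E₁ E₂ : ℝ}
    (hX : 0 ≤ cornerBound₂ (cwP F) (dwP F) F.z F.zb j E₁ E₂ (D.expo .φφφφ) (D.expo .φφφφ))
    (hY : 0 ≤ cornerBound₂ (cWeight2m F) (dWeight2m F) F.z F.zb j E₁ E₂ (D.expo .stts) (D.expo .stts))
    (hdet : max (-cornerBound₂ (cwQ F) (dwQ F) F.z F.zb j E₁ E₂ (expoQ D) (expoQ D))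
        (-cornerBound₂ (-cwQ F) (-dwQ F) F.z F.zb j E₁ E₂ (expoQ D) (expoQ D)) ^ 2 ≤
      4 * cornerBound₂ (cwP F) (dwP F) F.z F.zb j E₁ E₂ (D.expo .φφφφ) (D.expo .φφφφ) *
        cornerBound₂ (cWeight2m F) (dWeight2m F) F.z F.zb j E₁ E₂ (D.expo .stts) (D.expo .stts)) :
    ∀ E ∈ Icc E₁ E₂, kernelTest2p F D E j :=
  kernelTest2p_on_dbox F j (lo := D) (hi := D) hX hY hdet D
    ⟨⟨le_rfl, le_rfl⟩, ⟨le_rfl, le_rfl⟩, ⟨le_rfl, le_rfl⟩⟩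

end Literature.MathematicalPhysics.QuantumFieldTheory.O2ChargedDimBox
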